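import Summits.ABC.ABC.Theses.IsogenyGlueCongruence
import Summits.ABC.ABC.Theorems.EllipticGluingPrimeBound.Negative.LoadBearing
import Literature.AlgebraicGeometry.Motives.AbelianVarietyProductDimProofs
import Literature.AlgebraicGeometry.Motives.AbelianVarietyIsogenyProofs
import Literature.AlgebraicGeometry.Motives.AbelianVarietyBaseChange
import Literature.AlgebraicGeometry.Motives.AbelianVarietyPoincareCompleteReducibility
import Literature.AlgebraicGeometry.Motives.AbelianVarietyTorsionPointsCountProofs
import Literature.NumberTheory.EllipticCurves.RationalIsogenyDegreesProofs
import Literature.NumberTheory.EllipticCurves.OpenImage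
import Literature.NumberTheory.DiophantineGeometry.AVIsogenyQuasiInverse
import Literature.NumberTheory.DiophantineGeometry.AVKernelHopf
import HarnessLib

/-!
# Crux `EllipticGluingPrimeBound`, line Sketch — stub `stub_isotypicDichotomy` (the dichotomy)

Stub `stub_isotypicDichotomy` of line `Sketch` (isotypic–Minkowski reduction) of crux U
`Summit.ABC.ABC.Theses.IsogenyGlueCongruence.EllipticGluingPrimeBound` (item stmt-ABC-13919).

**Statement.** With `L₀ = 163`: let `W/ℚ` be an elliptic curve with AV-model `E` (a
`Γ_ℚ`-equivariant `e : E(ℚ̄) ≃+ W(ℚ̄)`), `B/ℚ` an abelian variety and `ℓ > L₀` a prime at which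
`(E, B)` is *glued*: some `E`-multiplier `α ≫ β = n • 𝟙 E` with `n ≠ 0` exists, and `ℓ` divides
every `E`-multiplier of `B`. Then EITHER `(E, B₁)` is glued at `ℓ` for some `B₁/ℚ` with
`dim B₁ ≤ dim B` all of whose non-zero geometric quotients receive a non-zero homomorphism from
`E_ℚ̄` (`B₁` is zero or geometrically `E`-isotypic), OR there is a geometrically `E`-free `A/ℚ`
(`Hom_ℚ̄(E_ℚ̄, A_ℚ̄) = 0`) with `dim A + 1 ≤ dim B` and `W[ℓ] ↪ A(ℚ̄)` `Γ_ℚ`-equivariantly.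

**Reduction (this file).** The theorem is proved from three inputs taken as hypotheses, each of
them a neighbouring stub of the line:
* `hMz` — Mazur's theorem (Mazur 1978, Thm. 1) as the tree's NAMED FACT
  `Literature.NumberTheory.EllipticCurves.mazur_isogeny_irreducible` (= `stub_mazurIrreducible`,
  unproved in the tree): `W[ℓ]` is an irreducible `Γ_ℚ`-module for `ℓ ∉ mazurPrimes`, so for every
  `ℓ > 163` (`not_mem_mazurPrimes_of_lt`); transported along `e` to `E[ℓ]` in
  `geomTorsion_le_of_stable`;
* `hS` — the geometrically-`E`-isotypic splitting over `ℚ` (= `stub_geomIsotypicSplitting`):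
  `(i, j) : B₁ ⊞ B₂ → B` an isogeny with `i` a closed immersion, `B₁` zero or geometrically
  `E`-isotypic, `Hom_ℚ̄(E, B₂) = 0`, and every `α : E → B` factoring through `i`;
* `hB` — the Case B engine (= `stub_caseB`): from a multiplier of `(E, B₁)` prime to `ℓ`, the
  divisibility by `ℓ` of every `E`-multiplier of `B` and the irreducibility of `E[ℓ]`, a quotient
  isogeny `h : B₂ → A` with `W[ℓ] ↪ A(ℚ̄)` equivariantly.

**Proof.** `dim E = 1` (`dim_eq_one_of_equiv`: `#E[2] = 2 ^ (2 dim E)` against `#W[2] = 4`), so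
`hS` applies. Case A (`ℓ` divides every multiplier of `(E, B₁)`): take `B₁` itself, glued via the
factorisation `α = α₁ ≫ i` and `i ≫ β`; `dim B₁ ≤ dim B₁ + dim B₂ = dim B`. Case B (some
multiplier of `(E, B₁)` is prime to `ℓ`): `hB` gives `h : B₂ → A`; `A` is geometrically `E`-free
because `B₂` is (isogeny invariance: compose with the base change of a quasi-inverse of `h` and
cancel the isogeny `[n]` of `E_ℚ̄`), and `dim A = dim B₂ = dim B - dim B₁ ≤ dim B - 1` because
`dim B₁ ≠ 0`: `α₁ ≫ (i ≫ β) = n • 𝟙 E` is a non-zero `E`-multiplier of `B₁`, and `End E` is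
torsion-free (the tree's `EllipticGluingPrimeBound.Negative.dim_ne_zero_of_multiplier` /
`zsmul_id_eq_zero_iff`, imported from `Theorems/EllipticGluingPrimeBound/Negative/LoadBearing`).

Public helpers (for the line's composition file): `map_mem_geomTorsion_iff`,
`nonempty_geomTorsionEquiv`, `dim_eq_one_of_equiv`, `geomTorsion_le_of_stable`; `End E`
torsion-free (`geomPointsMap_zsmul_id`, `zsmul_id_eq_zero_iff`, `dim_ne_zero_of_multiplier`) is NOT
restated — it is the tree's, namespace `Summit.ABC.ABC.Theorems.EllipticGluingPrimeBound.Negative`.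
Deliberately NOT here: no definitions (every notion is inlined in the tree's vocabulary, exactly as
registered), no proof of the three inputs, no cited fact other than the hypothesis `hMz`.
-/

noncomputable section

-- `Summit.<Summit>.<Problem>` is the mandated summit-side namespace (CONVENTIONS §2); for the
-- single-conjunct summit `ABC` the two coincide, so the duplicate `ABC.ABC` is deliberate.
set_option linter.dupNamespace false

namespace Summit.ABC.ABC.Theorems.IsotypicMinkowski

open CategoryTheory CategoryTheory.Limits AlgebraicGeometry
open Literature.AlgebraicGeometry.Motives
open Summit.ABC.ABC.Theses.IsogenyGlueCongruence

/-! ### Torsion along `e` and `dim E = 1` for an AV-model `E` of an elliptic curve -/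

/-- An additive isomorphism `e : E(ℚ̄) ≃+ W(ℚ̄)` preserves `n`-torsion:
`e P ∈ W[n] ↔ P ∈ E[n]`. -/
theorem map_mem_geomTorsion_iff {W : WeierstrassCurve ℚ} {E : AbelianVariety.{0} ℚ}
    (e : E.geomPoints ≃+ W.geomPoints) (n : ℤ) (P : E.geomPoints) :
    e P ∈ W.geomTorsion n ↔ P ∈ E.geomTorsion n := by
  rw [AbelianVariety.mem_geomTorsion_iff']
  constructor
  · intro h
    have h' := (Submodule.mem_torsionBy_iff n (e P)).1 h
    rwa [← map_zsmul, e.map_eq_zero_iff] at h'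
  · intro h
    exact (Submodule.mem_torsionBy_iff n (e P)).2 (by rw [← map_zsmul, h, map_zero])

/-- An additive isomorphism `e : E(ℚ̄) ≃+ W(ℚ̄)` restricts to a bijection `E[n] ≃ W[n]`
(stated as `Nonempty`, the restriction of `e` being the witness). -/
theorem nonempty_geomTorsionEquiv {W : WeierstrassCurve ℚ} {E : AbelianVariety.{0} ℚ}
    (e : E.geomPoints ≃+ W.geomPoints) (n : ℤ) : Nonempty (E.geomTorsion n ≃ W.geomTorsion n) :=
  ⟨e.toEquiv.subtypeEquiv fun P ↦ (map_mem_geomTorsion_iff e n P).symm⟩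

/-- **`dim E = 1`** for an AV-model `E` of an elliptic curve `W/ℚ`: `#E[2] = 2 ^ (2 dim E)`
(Mumford §6, App. 3: the tree's `natCard_torsionPoints_of_isAlgClosed_holds`, transported to
`E(ℚ̄)` by `AbelianVariety.natCard_geomTorsion`) while `#W[2] = 4`, and `E[2] ≃ W[2]` along `e`. -/
theorem dim_eq_one_of_equiv {W : WeierstrassCurve ℚ} [W.IsElliptic] {E : AbelianVariety.{0} ℚ}
    (e : E.geomPoints ≃+ W.geomPoints) : E.dim = 1 := by
  obtain ⟨f⟩ := nonempty_geomTorsionEquiv e 2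
  have h1 : Nat.card (E.geomTorsion 2) = (2 : ℤ).natAbs ^ (2 * E.dim) :=
    E.natCard_geomTorsion (AbelianVariety.natCard_torsionPoints_of_isAlgClosed_holds E _) 2
      (by norm_num)
  have h2 : Nat.card (W.geomTorsion 2) = (2 : ℤ).natAbs ^ 2 :=
    Literature.NumberTheory.EllipticCurves.natCard_geomTorsion_int_eq_sq W two_ne_zero
  rw [Nat.card_congr f, h2] at h1
  have h3 : 2 = 2 * E.dim := Nat.pow_right_injective (le_refl 2) (by simpa using h1)
  omega

/-! ### Mazur's theorem transported to `E[ℓ]` along `e` -/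

/-- **A non-zero `Γ_ℚ`-stable subgroup of `E[ℓ]` is all of `E[ℓ]` for a prime `ℓ > 163`**, given
Mazur's theorem as the named fact `mazur_isogeny_irreducible` (for `ℓ ∉ mazurPrimes`, all of which
are `≤ 163`, the only `Γ_ℚ`-stable subgroups of `W[ℓ]` are `⊥` and `⊤`), transported along the
equivariant isomorphism `e : E(ℚ̄) ≃+ W(ℚ̄)`: the image `H' ≤ W[ℓ]` of `H` is `Γ_ℚ`-stable, it is
`≠ ⊥` because `H ≠ ⊥`, hence `H' = ⊤`, i.e. `E[ℓ] ≤ H`. -/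
theorem geomTorsion_le_of_stable
    (hMz : Literature.NumberTheory.EllipticCurves.mazur_isogeny_irreducible)
    {W : WeierstrassCurve ℚ} [W.IsElliptic] {E : AbelianVariety.{0} ℚ}
    (e : E.geomPoints ≃+ W.geomPoints)
    (he : ∀ (σ : Field.absoluteGaloisGroup ℚ) (P : E.geomPoints), e (σ • P) = σ • e P)
    {ℓ : ℕ} (hℓ : ℓ.Prime) (hL : 163 < ℓ) (H : AddSubgroup E.geomPoints)
    (hH : H ≤ E.geomTorsion ℓ)
    (hstab : ∀ (σ : Field.absoluteGaloisGroup ℚ) (P : E.geomPoints), P ∈ H → σ • P ∈ H)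
    (hne : H ≠ ⊥) : E.geomTorsion ℓ ≤ H := by
  classical
  -- the transported subgroup of `W[ℓ]`
  let H' : AddSubgroup (W.geomTorsion ℓ) :=
    (H.map e.toAddMonoidHom).comap (W.geomTorsion ℓ).subtype
  have hirr := hMz W ℓ hℓ (Literature.NumberTheory.EllipticCurves.not_mem_mazurPrimes_of_lt hL)
  have hH'stab : ∀ (σ : Field.absoluteGaloisGroup ℚ) (Q : W.geomTorsion ℓ),
      Q ∈ H' → σ • Q ∈ H' := by
    intro σ Q hQ
    simp only [H', AddSubgroup.mem_comap, AddSubgroup.coe_subtype, AddSubgroup.mem_map] at hQ ⊢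
    obtain ⟨P, hP, hPQ⟩ := hQ
    refine ⟨σ • P, hstab σ P hP, ?_⟩
    change e (σ • P) = ((σ • Q : W.geomTorsion ℓ) : W.geomPoints)
    rw [he, Literature.NumberTheory.EllipticCurves.AddSubgroup.torsionBy.coe_smul]
    exact congrArg (σ • ·) hPQ
  rcases hirr H' hH'stab with h | h
  · -- `H' = ⊥` contradicts `H ≠ ⊥`
    exfalso
    apply hne
    rw [eq_bot_iff]
    intro P hP
    have hPt : e P ∈ W.geomTorsion ℓ := (map_mem_geomTorsion_iff e ℓ P).2 (hH hP)
    have hmem : (⟨e P, hPt⟩ : W.geomTorsion ℓ) ∈ H' := by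
      simp only [H', AddSubgroup.mem_comap, AddSubgroup.coe_subtype, AddSubgroup.mem_map]
      exact ⟨P, hP, rfl⟩
    rw [h, AddSubgroup.mem_bot] at hmem
    have : e P = 0 := congrArg Subtype.val hmem
    rw [AddSubgroup.mem_bot]
    exact e.map_eq_zero_iff.1 this
  · intro P hP
    have hPt : e P ∈ W.geomTorsion ℓ := (map_mem_geomTorsion_iff e ℓ P).2 hP
    have hmem : (⟨e P, hPt⟩ : W.geomTorsion ℓ) ∈ H' := by rw [h]; trivial
    simp only [H', AddSubgroup.mem_comap, AddSubgroup.coe_subtype, AddSubgroup.mem_map] at hmem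
    obtain ⟨P', hP', hPP'⟩ := hmem
    rwa [← e.injective hPP']

/-! ### Two private bookkeeping lemmas for the splitting `B₁ ⊞ B₂ → B` -/

/-- Geometric `E`-freeness is an isogeny invariant: if `h : A → A'` is an isogeny and
`Hom_ℚ̄(E, A) = 0` then `Hom_ℚ̄(E, A') = 0`. Compose `f : E_ℚ̄ → A'_ℚ̄` with the base change of a
quasi-inverse `g` of `h` (`g ≫ h = [n]`, `n ≥ 1`): `f ≫ g_ℚ̄ = 0`, so `f ≫ [n] = 0`, i.e.
`[n]_{E_ℚ̄} ≫ f = 0`, and the isogeny `[n]_{E_ℚ̄}` cancels. -/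
private theorem isGeomFree_of_isIsogeny {E A A' : AbelianVariety.{0} ℚ} {h : A ⟶ A'}
    (hh : AbelianVariety.IsIsogeny h)
    (hfree : ∀ f : E.baseChange (AlgebraicClosure ℚ) ⟶ A.baseChange (AlgebraicClosure ℚ), f = 0) :
    ∀ f : E.baseChange (AlgebraicClosure ℚ) ⟶ A'.baseChange (AlgebraicClosure ℚ), f = 0 := by
  intro f
  obtain ⟨g, n, hn, -, hgh⟩ := AbelianVariety.IsIsogeny.exists_nsmul_inverse_holds hh
  set L := AlgebraicClosure ℚ
  have h1 : f ≫ AbelianVariety.Hom.baseChange L g = 0 := hfree _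
  have h2 : f ≫ AbelianVariety.Hom.baseChange L (g ≫ h) = 0 := by
    rw [AbelianVariety.Hom.baseChange_comp, ← Category.assoc, h1, zero_comp]
  rw [hgh, show (n • 𝟙 A' : A' ⟶ A') = (n : ℤ) • 𝟙 A' from (natCast_zsmul _ _).symm,
    AbelianVariety.baseChange_zsmul_id, Preadditive.comp_zsmul, Category.comp_id,
    ← Category.id_comp f, ← Preadditive.zsmul_comp] at h2
  have hn' : ((n : ℤ) : L) ≠ 0 := by
    have : (n : L) ≠ 0 := by exact_mod_cast hn.ne'
    exact_mod_cast this
  exact (AbelianVariety.isIsogeny_zsmul_id_of_cast_ne_zero (A := E.baseChange L) (n : ℤ)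
    hn').cancel_left (h2.trans comp_zero.symm)

/-- `dim B = dim B₁ + dim B₂` when `(i, j) : B₁ ⊞ B₂ → B` is an isogeny (isogenous abelian
varieties have equal dimension; `B₁ ⊞ B₂ ≅ B₁ × B₂` and `dim (B₁ × B₂) = dim B₁ + dim B₂`). -/
private theorem dim_eq_add_of_isIsogeny_desc {B B₁ B₂ : AbelianVariety.{0} ℚ} (i : B₁ ⟶ B)
    (j : B₂ ⟶ B) (hσ : AbelianVariety.IsIsogeny (biprod.desc i j)) :
    B.dim = B₁.dim + B₂.dim := by
  have h1 : (B₁ ⊞ B₂).dim = B.dim := AbelianVariety.dim_eq_of_isIsogenous_holds ⟨_, hσ⟩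
  have h2 : (B₁ ⊞ B₂).dim = (B₁.prod B₂).dim :=
    AbelianVariety.dim_eq_of_isIsogenous_holds
      ⟨_, AbelianVariety.isIsogeny_hom_of_iso (AbelianVariety.biprodIsoProd B₁ B₂)⟩
  rw [← h1, h2, AbelianVariety.dim_prod]

/-! ### The dichotomy -/

/-- **Stub `stub_isotypicDichotomy` (card stub₂, DICHOTOMY) of line Sketch**, with `L₀ = 163`,
from Mazur's theorem (`hMz`, the named fact `mazur_isogeny_irreducible`), the
geometrically-`E`-isotypic splitting over `ℚ` (`hS`) and the Case B engine (`hB`): a pair `(E, B)`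
glued at a prime `ℓ > 163` (a non-zero `E`-multiplier exists and `ℓ` divides every
`E`-multiplier) either restricts to a glued pair `(E, B₁)` with `dim B₁ ≤ dim B` and `B₁`
zero-or-geometrically-`E`-isotypic (Case A: `ℓ` divides every multiplier of `(E, B₁)`; glue via
`α = α₁ ≫ i` and `i ≫ β`), or yields a geometrically `E`-free `A/ℚ` with `dim A + 1 ≤ dim B` and
`W[ℓ] ↪ A(ℚ̄)` equivariantly (Case B: a multiplier of `(E, B₁)` prime to `ℓ`; `hB` with the
irreducibility of `E[ℓ]` from `geomTorsion_le_of_stable`; `A` is `E`-free by isogeny invariance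
and `dim A = dim B₂ = dim B - dim B₁ ≤ dim B - 1`, the non-zero multiplier `α₁ ≫ (i ≫ β) = [n]`
forcing `dim B₁ ≠ 0`). -/
theorem stub_isotypicDichotomy
    (hMz : Literature.NumberTheory.EllipticCurves.mazur_isogeny_irreducible)
    (hS : ∀ (E B : AbelianVariety.{0} ℚ), E.dim = 1 →
      ∃ (B₁ B₂ : AbelianVariety.{0} ℚ) (i : B₁ ⟶ B) (j : B₂ ⟶ B),
        IsClosedImmersion (AbelianVariety.Hom.toSchemeHom i) ∧
        AbelianVariety.IsIsogeny (biprod.desc i j) ∧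
        (∀ (C : AbelianVariety.{0} (AlgebraicClosure ℚ))
            (g : B₁.baseChange (AlgebraicClosure ℚ) ⟶ C),
            Surjective (AbelianVariety.Hom.toSchemeHom g) → C.dim ≠ 0 →
            ∃ f : E.baseChange (AlgebraicClosure ℚ) ⟶ C, f ≠ 0) ∧
        (∀ f : E.baseChange (AlgebraicClosure ℚ) ⟶ B₂.baseChange (AlgebraicClosure ℚ), f = 0) ∧
        ∀ α : E ⟶ B, ∃ α₁ : E ⟶ B₁, α₁ ≫ i = α)
    (hB : ∀ (W : WeierstrassCurve ℚ) [W.IsElliptic] (E B B₁ B₂ : AbelianVariety.{0} ℚ)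
      (e : E.geomPoints ≃+ W.geomPoints),
      (∀ (σ : Field.absoluteGaloisGroup ℚ) (P : E.geomPoints), e (σ • P) = σ • e P) →
      ∀ ℓ : ℕ, ℓ.Prime →
      (∀ V : AddSubgroup E.geomPoints, V ≤ E.geomTorsion ℓ →
        (∀ (σ : Field.absoluteGaloisGroup ℚ) (P : E.geomPoints), P ∈ V → σ • P ∈ V) → V ≠ ⊥ →
        E.geomTorsion ℓ ≤ V) →
      (∀ (α : E ⟶ B) (β : B ⟶ E) (n : ℤ), α ≫ β = n • 𝟙 E → (ℓ : ℤ) ∣ n) →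
      ∀ (i : B₁ ⟶ B) (j : B₂ ⟶ B), IsClosedImmersion (AbelianVariety.Hom.toSchemeHom i) →
      AbelianVariety.IsIsogeny (biprod.desc i j) →
      ∀ (α₀ : E ⟶ B₁) (β₀ : B₁ ⟶ E) (m : ℤ), α₀ ≫ β₀ = m • 𝟙 E → ¬ (ℓ : ℤ) ∣ m →
      ∃ (A : AbelianVariety.{0} ℚ) (h : B₂ ⟶ A), AbelianVariety.IsIsogeny h ∧
        ∃ ι : W.geomTorsion ℓ →+ A.geomPoints, Function.Injective ι ∧
          ∀ (σ : Field.absoluteGaloisGroup ℚ) (P : W.geomTorsion ℓ), ι (σ • P) = σ • ι P) :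
    ∃ L₀ : ℕ, ∀ (W : WeierstrassCurve ℚ) [W.IsElliptic] (E B : AbelianVariety.{0} ℚ)
      (e : E.geomPoints ≃+ W.geomPoints),
      (∀ (σ : Field.absoluteGaloisGroup ℚ) (P : E.geomPoints), e (σ • P) = σ • e P) →
      ∀ ℓ : ℕ, ℓ.Prime → L₀ < ℓ →
      (∃ (α : E ⟶ B) (β : B ⟶ E) (n : ℤ), n ≠ 0 ∧ α ≫ β = n • 𝟙 E) →
      (∀ (α : E ⟶ B) (β : B ⟶ E) (n : ℤ), α ≫ β = n • 𝟙 E → (ℓ : ℤ) ∣ n) →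
      (∃ B₁ : AbelianVariety.{0} ℚ, B₁.dim ≤ B.dim ∧
        (∀ (C : AbelianVariety.{0} (AlgebraicClosure ℚ))
            (g : B₁.baseChange (AlgebraicClosure ℚ) ⟶ C),
            Surjective (AbelianVariety.Hom.toSchemeHom g) → C.dim ≠ 0 →
            ∃ f : E.baseChange (AlgebraicClosure ℚ) ⟶ C, f ≠ 0) ∧
        (∃ (α : E ⟶ B₁) (β : B₁ ⟶ E) (n : ℤ), n ≠ 0 ∧ α ≫ β = n • 𝟙 E) ∧
        (∀ (α : E ⟶ B₁) (β : B₁ ⟶ E) (n : ℤ), α ≫ β = n • 𝟙 E → (ℓ : ℤ) ∣ n)) ∨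
      (∃ A : AbelianVariety.{0} ℚ, A.dim + 1 ≤ B.dim ∧
        (∀ f : E.baseChange (AlgebraicClosure ℚ) ⟶ A.baseChange (AlgebraicClosure ℚ), f = 0) ∧
        ∃ ι : W.geomTorsion ℓ →+ A.geomPoints, Function.Injective ι ∧
          ∀ (σ : Field.absoluteGaloisGroup ℚ) (P : W.geomTorsion ℓ), ι (σ • P) = σ • ι P) := by
  refine ⟨163, ?_⟩
  intro W _ E B e he ℓ hℓ hL hex hall
  obtain ⟨α, β, n, hn, hαβ⟩ := hex
  obtain ⟨B₁, B₂, i, j, hi, hσ, hiso, hfree, hfac⟩ := hS E B (dim_eq_one_of_equiv e)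
  obtain ⟨α₁, hα₁⟩ := hfac α
  have hdim : B.dim = B₁.dim + B₂.dim := dim_eq_add_of_isIsogeny_desc i j hσ
  -- the non-zero `E`-multiplier `α₁ ≫ (i ≫ β) = n • 𝟙 E` of `B₁`; in particular `dim B₁ ≠ 0`
  have hmult : α₁ ≫ (i ≫ β) = n • 𝟙 E := by rw [← Category.assoc, hα₁, hαβ]
  have hB₁ : B₁.dim ≠ 0 :=
    Summit.ABC.ABC.Theorems.EllipticGluingPrimeBound.Negative.dim_ne_zero_of_multiplier e
      ⟨α₁, i ≫ β, n, hn, hmult⟩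
  by_cases hA : ∀ (α' : E ⟶ B₁) (β' : B₁ ⟶ E) (m : ℤ), α' ≫ β' = m • 𝟙 E → (ℓ : ℤ) ∣ m
  · -- Case A: the zero-or-isotypic part `B₁` is itself glued at `ℓ`
    exact Or.inl ⟨B₁, by omega, hiso, ⟨α₁, i ≫ β, n, hn, hmult⟩, hA⟩
  · -- Case B: a multiplier of `(E, B₁)` prime to `ℓ`; the Case B engine on the free complement
    push Not at hA
    obtain ⟨α₀, β₀, m, hm, hndvd⟩ := hA
    obtain ⟨A, h, hh, hemb⟩ := hB W E B B₁ B₂ e he ℓ hℓ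
      (geomTorsion_le_of_stable hMz e he hℓ hL) hall i j hi hσ α₀ β₀ m hm hndvd
    refine Or.inr ⟨A, ?_, isGeomFree_of_isIsogeny hh hfree, hemb⟩
    have hA₂ : B₂.dim = A.dim := AbelianVariety.dim_eq_of_isIsogenous_holds ⟨h, hh⟩
    omega

end Summit.ABC.ABC.Theorems.IsotypicMinkowski

end
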